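import Literature.Probability.LatticeModels.SixVertexGFFWick
import Literature.Analysis.Complex.HarmonicExtensionUniqueness

/-!
# Theorem 48, uniqueness step: harmonicity and the singularity analysis determine `Ψ_k`
# (DKLM 2026, Part II §2)

H. Duminil-Copin, K. K. Kozlowski, P. Lammers, I. Manolescu, *Gaussian free field convergence of
the six-vertex model with `-1 ≤ Δ ≤ -1/2`*, arXiv:2603.06268 (2026) [DKLM2026SixVertexGFF]
(`paper:arxiv-2603.06268`, chunks p0032–p0033):

> **Theorem 48.** If `Ψ₂ = σ² Ψ₂^GFF` then `Ψ_k = σ^k Ψ_k^GFF` for all `k`. […] *Proof.* […] For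
> fixed `u₁', (u_j, u_j')_{j>1}`, the function `u₁ ↦ Ψ_k(u)` has the following properties:
> **Harmonicity** (Proposition 49) away from the marked points; **Behaviour at infinity**: `Ψ_k(u)`
> tends to a finite constant as `|u₁| → ∞`; **Fusion asymptotics**: as `u₁ → v ∈ {u_i, u_i'}`,
> `Ψ_k(u) = Ψ₂(u₁,u₁',u_i,u_i') Ψ_{k-2}(…) + O(1)` where `Ψ₂ = σ²Ψ₂^GFF` and
> `Ψ_{k-2} = σ^{k-2}Ψ_{k-2}^GFF` by the induction hypothesis; **Value at one specific point**:
> `Ψ_k(u) = 0` at `u₁ = u₁'`. By extension theorems around singularities for harmonic functions,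
> these four properties fully determine the function `Ψ_k`, and yield `Ψ_k = σ^k Ψ_k^GFF`.

We formalize the concluding uniqueness step: a candidate `Ψ : ℂ → ℝ` (the unknown `u₀ ↦ Ψ_k(u)`)
that is harmonic off the marked points `T ⊇ {u_j, u_j' : j ≠ 0}`, whose difference with
`σ^k Ψ_k^GFF(u with u₀ := ·)` is bounded near each marked point (this is what the fusion asymptotics
of both sides give) and bounded at infinity (both sides tend to constants), and which vanishes at
`u₀ = u₀'`, coincides with `σ^k Ψ_k^GFF` off `T` — by the removable-singularity-plus-Liouville
uniqueness theorem `Literature.Analysis.Complex.eqOn_of_harmonic_off_finite` and the GFF-side facts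
(`harmonicAt_gffKPoint_update_fst`, and `Ψ_k^GFF = 0` at `u₀ = u₀'` from Wick's formula). The
six-vertex inputs (Proposition 49, Theorem mixing) enter as the hypotheses on `Ψ`.
-/

noncomputable section

open Metric Set Filter Topology InnerProductSpace

namespace Literature.Probability.LatticeModels.SixVertex

/-- `Ψ₂^GFF(u) = 0` when `u₀ = u₀'`. [cite: DKLM2026SixVertexGFF, Def. 2.6] -/
theorem gffKPoint_two_eq_zero_of_fst_eq (v : Fin 2 → ℂ × ℂ) (h : (v 0).1 = (v 0).2) : gffKPoint 2 v = 0 := by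
  rw [gffKPoint_two, h]
  ring

/-- **Value at one specific point**: `Ψ_k^GFF(u) = 0` at `u₀ = u₀'` (Wick's formula).
[cite: DKLM2026SixVertexGFF, Part II §2, proof of Theorem 48] -/
theorem gffKPoint_eq_zero_of_fst_eq {m : ℕ} (u : Fin (m + 2) → ℂ × ℂ) (h : (u 0).1 = (u 0).2) :
    gffKPoint (m + 2) u = 0 := by
  rw [gffKPoint_wick]
  refine Finset.sum_eq_zero fun j _ => ?_
  rw [gffKPoint_two_eq_zero_of_fst_eq _ (by simpa using h), zero_mul]

/-- **Theorem 48, uniqueness step (DKLM Part II §2).** Fix `u : Fin (m+2) → ℂ × ℂ`, `σ : ℝ` and a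
finite set `T` of marked points containing all `u_j, u_j'`, `j ≠ 0`, but not `u₀'`. If `Ψ : ℂ → ℝ`
is harmonic off `T`, `Ψ - σ^{m+2} Ψ_{m+2}^GFF(u with u₀ := ·)` is bounded near each point of `T` and
bounded at infinity, and `Ψ(u₀') = 0`, then `Ψ = σ^{m+2} Ψ_{m+2}^GFF(u with u₀ := ·)` off `T`.
[cite: DKLM2026SixVertexGFF, Part II §2, proof of Theorem 48] -/
theorem eq_gffKPoint_of_harmonic_offMarked {m : ℕ} (u : Fin (m + 2) → ℂ × ℂ) (σ : ℝ) (Ψ : ℂ → ℝ)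
    (T : Finset ℂ) (hT : ∀ j : Fin (m + 2), j ≠ 0 → (u j).1 ∈ T ∧ (u j).2 ∈ T) (h0 : (u 0).2 ∉ (T : Set ℂ))
    (hharm : ∀ z ∉ (T : Set ℂ), HarmonicAt Ψ z)
    (hloc : ∀ s ∈ T, ∃ ε > 0, ∃ M : ℝ, ∀ z ∈ ball s ε \ {s},
      |Ψ z - σ ^ (m + 2) * gffKPoint (m + 2) (Function.update u 0 (z, (u 0).2))| ≤ M)
    (hinf : ∃ r M : ℝ, ∀ z : ℂ, r ≤ ‖z‖ →
      |Ψ z - σ ^ (m + 2) * gffKPoint (m + 2) (Function.update u 0 (z, (u 0).2))| ≤ M)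
    (hval : Ψ (u 0).2 = 0) :
    ∀ z ∉ (T : Set ℂ), Ψ z = σ ^ (m + 2) * gffKPoint (m + 2) (Function.update u 0 (z, (u 0).2)) := by
  refine Literature.Analysis.Complex.eqOn_of_harmonic_off_finite T hharm (fun z hz => ?_) hloc hinf h0 ?_
  · refine harmonicAt_const_mul _ (harmonicAt_gffKPoint_update_fst u 0 z fun j hj => ⟨?_, ?_⟩)
    · intro h; exact hz (h ▸ (hT j hj).1)
    · intro h; exact hz (h ▸ (hT j hj).2)
  · rw [hval, gffKPoint_eq_zero_of_fst_eq _ (by simp), mul_zero]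

end Literature.Probability.LatticeModels.SixVertex

end
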